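import Summits.CriticalPhenomena.PercolationContinuityZ3.Theorems.PercAnnulusCrossingIICEdgeBiasAll
import Summits.CriticalPhenomena.PercolationContinuityZ3.Theorems.PercAnnulusCrossingIICSupport
import Summits.CriticalPhenomena.PercolationContinuityZ3.Theorems.PercAnnulusCrossingSupercriticalSetToSetDefectLower
import HarnessLib

/-!
# No lattice edge is trivial under Kesten's IIC: `p < ν(e open) < 1` (lane RSW3, p1 gen 8)

builds on p205010 (kernel theorem, internal audit signed; external expert review pending) — NOT used in this file.

RSW3 lane (LANE 3 `prim-rsw3`), seat `prim-rsw3-p1` (gen 8).  Helper file (`--supports stmt-CriticalPhenomena-4575`); no definitions, no sorries.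
`…IICEdgeBiasAll` gives `p < ν(e open)` for every lattice edge.  The upper bound `ν(e open) < 1` comes from the support theorem of `…IICSupport`
(`ν(E) = 0 ⟺ P_p(E ∩ {0 ↔ ∂ⁱⁿΛ(a)}) = 0`): the pattern '`e` closed' is compatible with an arm, because the two-staircase lemma of `…BoxStaircase`
gives a lattice path from `0` to a shell point of `Λ(m)` avoiding one endpoint of `e` (`m` = the shell index of the outer endpoint).

* `exists_pathIn_box_avoiding` — for every `b ∈ Λ(m) ∖ Λ(m−1)`, `m ≥ 1`, `d ≥ 1`: some `x ∈ ∂ⁱⁿΛ(m)`, `x ≠ b`, with `PathIn (zdGraph d) (↑Λ(m) ∖ {b}) 0 x`;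
* **`iicMeasure_real_latticeEdge_lt_one`** — (A2)□ at `(s,L)` (`1 ≤ s`, `ϰ > 0`), `0 < p < 1`, `d ≥ 1`, IIC probability measure: `ν(s(a,b) ∈ ω) < 1` for
  every lattice edge;
* **`iicMeasure_real_latticeEdge_mem_Ioo`** — with `…IICEdgeBiasAll` (`d ≥ 2`): **`ν(s(a,b) ∈ ω) ∈ (p, 1)` for every lattice edge `a ∼ b`.**
References: H. Kesten, PTRF 73 (1986) Thm (3); D. Basu, A. Sapozhnikov, ECP 22 (2017) no. 26, Thm 1.1.
-/

noncomputable section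

namespace Summit.CriticalPhenomena.PercolationContinuityZ3.Theorems.Crossing

open MeasureTheory Filter Topology Literature.Probability.Percolation Literature.Probability.LatticeModels
open Literature.Probability.Percolation.DCT16

variable {d : ℕ}

/-- For a shell point `b ∈ Λ(m) ∖ Λ(m−1)` (`m ≥ 1`, `d ≥ 1`) there is a lattice path from `0` to some `x ∈ ∂ⁱⁿΛ(m)`, `x ≠ b`, inside `Λ(m) ∖ {b}`
(target `±m·e₀`, two-staircase lemma). [folklore] -/
theorem exists_pathIn_box_avoiding (hd : 1 ≤ d) {m : ℕ} (hm : 1 ≤ m) {b : Site d} (hb : b ∉ box d (m - 1)) :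
    ∃ x : Site d, x ∈ innerBoundary (zdGraph d) (box d m) ∧ x ≠ b ∧ PathIn (zdGraph d) ((↑(box d m) : Set (Site d)) \ {b}) 0 x := by
  set i₀ : Fin d := ⟨0, by omega⟩ with hi₀
  -- the two candidates `± m e₀`
  set xp : Site d := Pi.single i₀ (m : ℤ) with hxp
  set xm : Site d := Pi.single i₀ (-(m : ℤ)) with hxm
  have hmem : ∀ (σ : ℤ), (σ = m ∨ σ = -(m : ℤ)) → (Pi.single i₀ σ : Site d) ∈ box d m ∧ (Pi.single i₀ σ : Site d) ∉ box d (m - 1) := by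
    intro σ hσ
    constructor
    · rw [mem_box]; intro i
      by_cases hi : i = i₀
      · subst hi; simp; omega
      · simp [Pi.single_eq_of_ne hi]
    · rw [mem_box, not_forall]
      refine ⟨i₀, ?_⟩
      simp; omega
  have hxp' := hmem (m : ℤ) (Or.inl rfl)
  have hxm' := hmem (-(m : ℤ)) (Or.inr rfl)
  have hne : xp ≠ xm := by
    intro h
    have := congrFun h i₀
    simp [hxp, hxm] at this
    omega
  by_cases hb1 : b = xp
  · have hxmb : xm ≠ b := fun h => hne (h.trans hb1).symm
    exact ⟨xm, mem_innerBoundary_box_of_notMem_pred hm hxm'.1 hxm'.2, hxmb, pathIn_box_sdiff_singleton_zero hm hxm'.1 hb hxmb⟩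
  · have hxpb : xp ≠ b := fun h => hb1 h.symm
    exact ⟨xp, mem_innerBoundary_box_of_notMem_pred hm hxp'.1 hxp'.2, hxpb, pathIn_box_sdiff_singleton_zero hm hxp'.1 hb hxpb⟩

/-- **`ν(e open) < 1` for every lattice edge**: under (A2)□ at aspect `(s,L)` (`1 ≤ s`, `ϰ > 0`), `0 < p < 1`, `d ≥ 1`, for every IIC probability
measure `ν` and every lattice edge `a ∼ b`: `ν(s(a,b) ∈ ω) < 1` — the pattern '`s(a,b)` closed' is compatible with an arm avoiding the outer endpoint.
[cite: Kesten1986, Thm. (3)] [cite: BasuSapozhnikov2017ECP, Thm. 1.1] -/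
theorem iicMeasure_real_latticeEdge_lt_one (hd : 1 ≤ d) (p : unitInterval) (hp : 0 < (p : ℝ)) (hp1 : (p : ℝ) < 1) {s L : ℕ} (hs : 1 ≤ s)
    {ϰ : ℝ} (hϰ : 0 < ϰ) (hA2 : SetToSetQuasiMultAspectAt d p s L ϰ) {ν : Measure (BondConfig (Site d))} [IsProbabilityMeasure ν]
    (hν : ∀ (F : Finset (Sym2 (Site d))) (E : Set (BondConfig (Site d))), MeasurableSet E → DeterminedBy E ↑F →
      Tendsto (fun n : ℕ => (bondPercolation (zdGraph d) p).real (E ∩ siteToBoundary d n) / oneArmProb d p n)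
        atTop (𝓝 (ν.real E)))
    {a b : Site d} (hab : (zdGraph d).Adj a b) :
    ν.real {ω : BondConfig (Site d) | s(a, b) ∈ ω} < 1 := by
  classical
  set μ := bondPercolation (zdGraph d) p with hμ
  set e₀ : Sym2 (Site d) := s(a, b) with he₀
  -- shell indices: `m` = the first box containing both endpoints; the endpoint NOT in `Λ(m-1)` is the avoided point
  obtain ⟨N, hN⟩ := exists_subset_box ({a, b} : Finset (Site d))
  have hex : ∃ n, a ∈ box d n ∧ b ∈ box d n := ⟨N, hN (by simp), hN (by simp)⟩
  set m := Nat.find hex with hmdef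
  obtain ⟨ham, hbm⟩ : a ∈ box d m ∧ b ∈ box d m := Nat.find_spec hex
  have hmin : ∀ k, k < m → ¬ (a ∈ box d k ∧ b ∈ box d k) := fun k hk => Nat.find_min hex hk
  have hm1 : 1 ≤ m := by
    by_contra h0
    have h0' : m = 0 := by omega
    apply hab.ne
    have ha0 : a ∈ box d 0 := h0' ▸ ham
    have hb0 : b ∈ box d 0 := h0' ▸ hbm
    rw [mem_box] at ha0 hb0
    funext i
    have := ha0 i; have := hb0 i
    push_cast at *
    omega
  -- the avoided endpoint `w ∈ {a,b}`, `w ∉ Λ(m-1)`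
  obtain ⟨w, hw, hwm⟩ : ∃ w, (w = a ∨ w = b) ∧ w ∉ box d (m - 1) := by
    by_cases ha' : a ∈ box d (m - 1)
    · refine ⟨b, Or.inr rfl, fun hb' => hmin (m - 1) (by omega) ⟨ha', hb'⟩⟩
    · exact ⟨a, Or.inl rfl, ha'⟩
  obtain ⟨x, hx, hxw, hP⟩ := exists_pathIn_box_avoiding hd hm1 hwm
  -- the event `{all lattice edges of Λ(m) other than e₀ open} ∩ {e₀ closed}` has positive probability and implies `{e₀ closed} ∩ A_m`
  set G : Finset (Sym2 (Site d)) := (((box d m).sym2).filter fun g => g ∈ (zdGraph d).edgeSet).erase e₀ with hG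
  have hGE : ∀ g ∈ G, g ∈ (zdGraph d).edgeSet := fun g hg => (Finset.mem_filter.1 (Finset.mem_erase.1 hg).2).2
  have hdetG : DeterminedBy {ω : BondConfig (Site d) | ∀ g ∈ G, g ∈ ω} (↑G : Set (Sym2 (Site d))) := by
    rw [determinedBy_iff]; intro ω ω' h
    have key : ∀ g ∈ G, (g ∈ ω ↔ g ∈ ω') := fun g hg =>
      ⟨fun h1 => (((Set.ext_iff.1 h) g).1 ⟨h1, Finset.mem_coe.2 hg⟩).1, fun h1 => (((Set.ext_iff.1 h) g).2 ⟨h1, Finset.mem_coe.2 hg⟩).1⟩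
    simp only [Set.mem_setOf_eq]
    exact forall₂_congr fun g hg => key g hg
  have hdetC : DeterminedBy {ω : BondConfig (Site d) | e₀ ∉ ω} (↑({e₀} : Finset (Sym2 (Site d))) : Set (Sym2 (Site d))) := by
    rw [determinedBy_iff]; intro ω ω' h
    have := (Set.ext_iff.1 h) e₀
    simp only [Set.mem_inter_iff, Finset.coe_singleton, Set.mem_singleton_iff, and_true] at this
    simp only [Set.mem_setOf_eq, this]
  have hdisj : Disjoint (↑G : Set (Sym2 (Site d))) ↑({e₀} : Finset (Sym2 (Site d))) := by
    rw [Finset.disjoint_coe, Finset.disjoint_singleton_right, hG]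
    exact Finset.notMem_erase e₀ _
  have hpos : 0 < μ.real ({ω : BondConfig (Site d) | ∀ g ∈ G, g ∈ ω} ∩ {ω : BondConfig (Site d) | e₀ ∉ ω}) := by
    rw [bondPercolation_real_inter_of_disjoint (zdGraph d) p hdisj hdetG hdetC hdetG.measurableSet_of_finset (measurableSet_notMem e₀)]
    refine mul_pos (lt_of_lt_of_le (pow_pos hp _) (pow_le_real_forall_mem p G hGE)) ?_
    have hc : μ.real {ω : BondConfig (Site d) | e₀ ∉ ω} = 1 - p := by
      have hset : {ω : BondConfig (Site d) | e₀ ∉ ω} = {ω : BondConfig (Site d) | e₀ ∈ ω}ᶜ := by ext ω; simp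
      rw [hset, measureReal_compl (measurableSet_mem e₀), probReal_univ, bondPercolation_cylinder (zdGraph d) p ((SimpleGraph.mem_edgeSet _).2 hab)]
    rw [hc]; linarith
  have hsub : {ω : BondConfig (Site d) | ∀ g ∈ G, g ∈ ω} ∩ {ω : BondConfig (Site d) | e₀ ∉ ω} ⊆ {ω : BondConfig (Site d) | e₀ ∉ ω} ∩ siteToBoundary d m := by
    rintro ω ⟨hopen, hcl⟩
    refine ⟨hcl, x, hx, mem_openConnIn_of_pathIn (pathIn_transfer hP (Finset.mem_coe.2 (zero_mem_box d m)) fun z y hz hy _ hzy => ⟨hy.1, ?_⟩)⟩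
    rw [openGraph_adj]
    refine ⟨hopen _ (Finset.mem_erase.2 ⟨fun h => ?_, Finset.mem_filter.2 ⟨Finset.mk_mem_sym2_iff.2 ⟨Finset.mem_coe.1 hz.1, Finset.mem_coe.1 hy.1⟩,
      (SimpleGraph.mem_edgeSet _).2 hzy⟩⟩), hzy.ne⟩
    -- `s(z,y) = e₀` would put the avoided endpoint `w` on the path
    rw [he₀, Sym2.eq_iff] at h
    rcases hw with rfl | rfl
    · rcases h with ⟨h1, -⟩ | ⟨-, h1⟩
      · exact hz.2 (by rw [h1]; rfl)
      · exact hy.2 (by rw [h1]; rfl)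
    · rcases h with ⟨-, h1⟩ | ⟨h1, -⟩
      · exact hy.2 (by rw [h1]; rfl)
      · exact hz.2 (by rw [h1]; rfl)
  have hposA : 0 < μ.real ({ω : BondConfig (Site d) | e₀ ∉ ω} ∩ siteToBoundary d m) :=
    lt_of_lt_of_le hpos (measureReal_mono hsub (measure_ne_top μ _))
  -- `{e₀ closed}` is a cylinder of `Λ(m)`
  have hdetm : DeterminedBy {ω : BondConfig (Site d) | e₀ ∉ ω} (↑((box d m).sym2) : Set (Sym2 (Site d))) :=
    hdetC.mono (by
      rw [Finset.coe_subset, Finset.singleton_subset_iff, he₀, Finset.mk_mem_sym2_iff]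
      exact ⟨ham, hbm⟩)
  have hνcl : ν.real {ω : BondConfig (Site d) | e₀ ∉ ω} ≠ 0 := fun h0 =>
    hposA.ne' ((iicMeasure_real_eq_zero_iff hd p hp hs hϰ hA2 hν hdetm).1 h0)
  have hνcl' : 0 < ν.real {ω : BondConfig (Site d) | e₀ ∉ ω} := lt_of_le_of_ne measureReal_nonneg (Ne.symm hνcl)
  have hcompl : ν.real {ω : BondConfig (Site d) | e₀ ∉ ω} = 1 - ν.real {ω : BondConfig (Site d) | e₀ ∈ ω} := by
    have hset : {ω : BondConfig (Site d) | e₀ ∉ ω} = {ω : BondConfig (Site d) | e₀ ∈ ω}ᶜ := by ext ω; simp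
    rw [hset, measureReal_compl (measurableSet_mem e₀), probReal_univ]
  rw [hcompl] at hνcl'
  linarith

/-- **No lattice edge is trivial under Kesten's IIC: `ν(s(a,b) ∈ ω) ∈ (p, 1)`** for every edge `a ∼ b` of `ℤ^d` (`d ≥ 2`), every IIC probability
measure at `p` (`0 < p < 1`) under (A2)□ at aspect `(s,L)` (`1 ≤ s`, `ϰ > 0`). [cite: Kesten1986, Thm. (3)] [cite: BasuSapozhnikov2017ECP, Thm. 1.1] -/
theorem iicMeasure_real_latticeEdge_mem_Ioo (hd : 2 ≤ d) (p : unitInterval) (hp : 0 < (p : ℝ)) (hp1 : (p : ℝ) < 1) {s L : ℕ} (hs : 1 ≤ s)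
    {ϰ : ℝ} (hϰ : 0 < ϰ) (hA2 : SetToSetQuasiMultAspectAt d p s L ϰ) {ν : Measure (BondConfig (Site d))} [IsProbabilityMeasure ν]
    (hν : ∀ (F : Finset (Sym2 (Site d))) (E : Set (BondConfig (Site d))), MeasurableSet E → DeterminedBy E ↑F →
      Tendsto (fun n : ℕ => (bondPercolation (zdGraph d) p).real (E ∩ siteToBoundary d n) / oneArmProb d p n)
        atTop (𝓝 (ν.real E)))
    {a b : Site d} (hab : (zdGraph d).Adj a b) :
    ν.real {ω : BondConfig (Site d) | s(a, b) ∈ ω} ∈ Set.Ioo (p : ℝ) 1 :=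
  ⟨iicMeasure_real_latticeEdge_gt hd p hp hp1 hs hϰ hA2 hν hab, iicMeasure_real_latticeEdge_lt_one (by omega) p hp hp1 hs hϰ hA2 hν hab⟩

end Summit.CriticalPhenomena.PercolationContinuityZ3.Theorems.Crossing
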